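import Literature.MathematicalPhysics.QuantumFieldTheory.WilsonFinTorusTwistedPartition
import HarnessLib

/-!
# Strong-coupling twist bound without a cluster expansion — PART A: pointwise bookkeeping

Helper (part A of two) for crux `IRcof` (stmt-QuantumFields-26930), line «mk-lag-sandwich» (ym-ir-idea-19), support stub S_sc
`SCTwistBound`; see the module docstring of `Theorems/IR/MKLagSandwichSCTwist.lean` (part B) for the statement and the argument.
This part is measure-free: elementary bounds for a plaquette weight `w` with `sup|w − 1| ≤ ε ≤ 1/2` (§1), a generic product
estimate (§2), the `Fin`-box geometry of shifts and of the one-link substitution `U_e ↦ c·U_e` (§3), 't Hooft's twist factors (§4),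
the bound `W(U') ≤ κ¹⁸ W(U)`, `κ = (1+ε)/(1−ε)`, for the untwisted weight `W = ∏_p w(U_p)` under one link substitution (at most 3 sites
in each of the 6 planes change; §5), and the count of the `3L²` stack positions (§7).

HONEST FRAMING: finite-box algebra; the Yang–Mills mass gap (Clay) is NOT proved; R4 = `BalabanLadder.UV` only.
-/

set_option autoImplicit false

noncomputable section

open MeasureTheory Finset
open Literature.MathematicalPhysics.QuantumFieldTheory Literature.MathematicalPhysics.QuantumLattice

namespace Summit.QuantumFields.YangMills.Cruxes.IRcof.MKLagSandwich.SCTwist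

/-! ## §1 Elementary bounds for a weight within `ε` of `1` -/

section Weight

variable {G : Type} (w : G → ℝ) {ε : ℝ}

/-- `1 − ε ≤ w(a)`. -/
theorem le_weight (hw : ∀ a, |w a - 1| ≤ ε) (a : G) : 1 - ε ≤ w a := by
  have := (abs_le.1 (hw a)).1; linarith

/-- `w(a) ≤ 1 + ε`. -/
theorem weight_le (hw : ∀ a, |w a - 1| ≤ ε) (a : G) : w a ≤ 1 + ε := by
  have := (abs_le.1 (hw a)).2; linarith

/-- `0 < w(a)` when `ε ≤ 1/2`. -/
theorem weight_pos (hw : ∀ a, |w a - 1| ≤ ε) (hε : ε ≤ 1 / 2) (a : G) : 0 < w a := by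
  have := le_weight w hw a; linarith

/-- The one-factor ratio bound `w(a) ≤ κ · w(b)`, `κ = (1+ε)/(1−ε)`. -/
theorem weight_le_kap_mul (hw : ∀ a, |w a - 1| ≤ ε) (hε : ε ≤ 1 / 2) (a b : G) :
    w a ≤ (1 + ε) / (1 - ε) * w b := by
  have h1 : 0 < 1 - ε := by linarith
  have hb := le_weight w hw b
  have ha := weight_le w hw a
  calc w a ≤ 1 + ε := ha
    _ = (1 + ε) / (1 - ε) * (1 - ε) := by field_simp
    _ ≤ (1 + ε) / (1 - ε) * w b := by
        have hε0 : 0 ≤ ε := le_trans (abs_nonneg _) (hw a)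
        exact mul_le_mul_of_nonneg_left hb (div_nonneg (by linarith) h1.le)

/-- `1 ≤ κ`. -/
theorem one_le_kap (hw : ∀ a, |w a - 1| ≤ ε) (hε : ε ≤ 1 / 2) (a : G) : 1 ≤ (1 + ε) / (1 - ε) := by
  have hε0 : 0 ≤ ε := le_trans (abs_nonneg _) (hw a)
  rw [le_div_iff₀ (by linarith)]; linarith

/-- `|log w(a)| ≤ ε/(1−ε)`. -/
theorem abs_log_weight_le (hw : ∀ a, |w a - 1| ≤ ε) (hε : ε ≤ 1 / 2) (a : G) :
    |Real.log (w a)| ≤ ε / (1 - ε) := by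
  have hε0 : 0 ≤ ε := le_trans (abs_nonneg _) (hw a)
  have h1 : 0 < 1 - ε := by linarith
  have hpos := weight_pos w hw hε a
  rw [abs_le]
  constructor
  · -- `-ε/(1-ε) = 1 - 1/(1-ε) ≤ log (1-ε) ≤ log w(a)`
    have hlo : Real.log (1 - ε) ≤ Real.log (w a) := Real.log_le_log h1 (le_weight w hw a)
    have h2 : 1 - (1 - ε)⁻¹ ≤ Real.log (1 - ε) := Real.one_sub_inv_le_log_of_pos h1
    have h3 : -(ε / (1 - ε)) = 1 - (1 - ε)⁻¹ := by field_simp; ring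
    linarith
  · have hhi : Real.log (w a) ≤ w a - 1 := Real.log_le_sub_one_of_pos hpos
    have h4 : w a - 1 ≤ ε := by linarith [weight_le w hw a]
    have h5 : ε ≤ ε / (1 - ε) := by
      rw [le_div_iff₀ h1]; nlinarith
    linarith

end Weight

/-! ## §2 A generic product estimate: change at most `m` factors, each by at most `κ` -/

/-- If `F'` agrees with `F ≥ 0` off a set of at most `m` indices and `F' ≤ κ F` everywhere (`κ ≥ 1`), then `∏ F' ≤ κᵐ ∏ F`. -/
theorem prod_le_pow_mul_prod {ι : Type*} [Fintype ι] [DecidableEq ι] (Exc : Finset ι) {m : ℕ} (hm : Exc.card ≤ m)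
    {κ : ℝ} (hκ : 1 ≤ κ) {F F' : ι → ℝ} (hF : ∀ i, 0 ≤ F i) (hF' : ∀ i, 0 ≤ F' i)
    (heq : ∀ i, i ∉ Exc → F' i = F i) (hle : ∀ i, F' i ≤ κ * F i) :
    ∏ i, F' i ≤ κ ^ m * ∏ i, F i := by
  calc ∏ i, F' i ≤ ∏ i, ((if i ∈ Exc then κ else 1) * F i) := by
        refine Finset.prod_le_prod (fun i _ => hF' i) fun i _ => ?_
        split_ifs with h
        · exact hle i
        · rw [one_mul, heq i h]
    _ = (∏ i, (if i ∈ Exc then κ else 1)) * ∏ i, F i := Finset.prod_mul_distrib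
    _ = κ ^ Exc.card * ∏ i, F i := by
        rw [Finset.prod_ite_mem, Finset.univ_inter, Finset.prod_const]
    _ ≤ κ ^ m * ∏ i, F i :=
        mul_le_mul_of_nonneg_right (pow_le_pow_right₀ hκ hm) (Finset.prod_nonneg fun i _ => hF i)

/-! ## §3 Lattice geometry of the `Fin`-box: shifts, the link substitution, the stack positions -/

section Geometry

variable {n₀ n₁ n₂ n₃ : ℕ}

/-- The shift `x ↦ x + e_μ` of the `Fin`-box is injective (it is `finRotate` in one coordinate). -/
theorem shift_injective (μ : Fin 4) : Function.Injective fun x : FinTorusSite n₀ n₁ n₂ n₃ => x.shift μ := by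
  intro x y h
  obtain ⟨x0, x1, x2, x3⟩ := x
  obtain ⟨y0, y1, y2, y3⟩ := y
  fin_cases μ <;>
    simp only [FinTorusSite.shift, Fin.zero_eta, Fin.mk_one, Fin.reduceFinMk, Matrix.cons_val_zero, Matrix.cons_val_one,
      Matrix.cons_val, Prod.mk.injEq, (finRotate _).injective.eq_iff] at h <;>
    obtain ⟨h0, h1, h2, h3⟩ := h <;> subst h0 <;> subst h1 <;> subst h2 <;> subst h3 <;> rfl

variable {L t : ℕ}

/-- On a box of temporal extent `t ≥ 2`, `x + e₃ ≠ x`. -/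
theorem shift_three_ne_self (ht : 2 ≤ t) (x : FinTorusSite L L L t) : x.shift 3 ≠ x := by
  obtain ⟨x0, x1, x2, x3⟩ := x
  obtain ⟨m, rfl⟩ : ∃ m, t = m + 2 := ⟨t - 2, by omega⟩
  intro h
  simp only [FinTorusSite.shift, Matrix.cons_val, Prod.mk.injEq, true_and] at h
  rw [finRotate_apply] at h
  have h1 : (1 : Fin (m + 2)) = 0 := by
    have := congrArg (fun y => y - x3) h
    simp at this
  exact absurd (Fin.one_eq_zero_iff.1 h1) (by omega)

end Geometry

section Plaquette

variable {G : Type} [Group G] {n₀ n₁ n₂ n₃ : ℕ}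

/-- A plaquette none of whose four links is `e` is unchanged by the substitution `U_e ↦ c·U_e`. -/
theorem plaquette_update_of_ne (U : FinTorusSite n₀ n₁ n₂ n₃ × Fin 4 → G) (e : FinTorusSite n₀ n₁ n₂ n₃ × Fin 4) (c : G)
    (x : FinTorusSite n₀ n₁ n₂ n₃) (a b : Fin 4) (h1 : (x, a) ≠ e) (h2 : (x.shift a, b) ≠ e) (h3 : (x.shift b, a) ≠ e)
    (h4 : (x, b) ≠ e) :
    finTorusPlaquette (Function.update U e (c * U e)) x a b = finTorusPlaquette U x a b := by
  unfold finTorusPlaquette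
  rw [Function.update_of_ne h1, Function.update_of_ne h2, Function.update_of_ne h3, Function.update_of_ne h4]

/-- The substitution `U_e ↦ c·U_e` on the FIRST link `e = (x, a)` of the plaquette `(x; a, b)` multiplies its holonomy by `c` on the left
(when the other three links differ from `e`). -/
theorem plaquette_update_first (U : FinTorusSite n₀ n₁ n₂ n₃ × Fin 4 → G) (c : G) (x : FinTorusSite n₀ n₁ n₂ n₃) (a b : Fin 4)
    (h2 : (x.shift a, b) ≠ (x, a)) (h3 : (x.shift b, a) ≠ (x, a)) (h4 : (x, b) ≠ (x, a)) :
    finTorusPlaquette (Function.update U (x, a) (c * U (x, a))) x a b = c * finTorusPlaquette U x a b := by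
  unfold finTorusPlaquette
  rw [Function.update_self, Function.update_of_ne h2, Function.update_of_ne h3, Function.update_of_ne h4]
  simp only [mul_assoc]

end Plaquette

/-! ## §4 The twist factors -/

section Twist

variable {G : Type} [Group G] {n₀ n₁ n₂ n₃ : ℕ}

/-- No twist: every factor of `z = 1` is `1`. -/
theorem twistFactor_one (x : FinTorusSite n₀ n₁ n₂ n₃) (μ ν : Fin 4) : tHooftTwistFactor (1 : Fin 4 → G) x μ ν = 1 := by
  unfold tHooftTwistFactor; split_ifs <;> rfl

/-- Off the stacks the twist factor is `1`. -/
theorem twistFactor_of_not (z : Fin 4 → G) (x : FinTorusSite n₀ n₁ n₂ n₃) (μ ν : Fin 4)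
    (h : ¬ (ν = 3 ∧ finTorusSiteCoord x 3 = 0 ∧ finTorusSiteCoord x μ = 0)) : tHooftTwistFactor z x μ ν = 1 := by
  unfold tHooftTwistFactor; rw [if_neg h]

/-- On the stack of direction `μ` the twist factor is `z μ`. -/
theorem twistFactor_of (z : Fin 4 → G) (x : FinTorusSite n₀ n₁ n₂ n₃) (μ ν : Fin 4)
    (h : ν = 3 ∧ finTorusSiteCoord x 3 = 0 ∧ finTorusSiteCoord x μ = 0) : tHooftTwistFactor z x μ ν = z μ := by
  unfold tHooftTwistFactor; rw [if_pos h]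

end Twist

/-! ## §5 The untwisted weight changes by at most `κ¹⁸` under one link substitution -/

section WeightProduct

variable {G : Type} [Group G] {L t : ℕ} (w : G → ℝ) {ε : ℝ}

/-- In ONE plane, the substitution `U_e ↦ c·U_e` changes at most three plaquette factors (those based at `e.1`, `e.1 − e_a`,
`e.1 − e_b`), each by at most `κ`: `∏_x w(U'_{x;ab}) ≤ κ³ ∏_x w(U_{x;ab})`. -/
theorem prod_sites_update_le (hw : ∀ a, |w a - 1| ≤ ε) (hε : ε ≤ 1 / 2) (U : FinTorusSite L L L t × Fin 4 → G)
    (e : FinTorusSite L L L t × Fin 4) (c : G) (q : {q : Fin 4 × Fin 4 // q.1 < q.2}) :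
    ∏ x : FinTorusSite L L L t, w (finTorusPlaquette (Function.update U e (c * U e)) x q.1.1 q.1.2) ≤
      ((1 + ε) / (1 - ε)) ^ 3 * ∏ x : FinTorusSite L L L t, w (finTorusPlaquette U x q.1.1 q.1.2) := by
  classical
  set Exc : Finset (FinTorusSite L L L t) :=
    {e.1} ∪ (univ.filter fun x => x.shift q.1.1 = e.1) ∪ (univ.filter fun x => x.shift q.1.2 = e.1) with hExc
  have hcard : Exc.card ≤ 3 := by
    have h1 : (univ.filter fun x : FinTorusSite L L L t => x.shift q.1.1 = e.1).card ≤ 1 :=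
      Finset.card_le_one.2 fun a ha b hb => by
        rw [Finset.mem_filter] at ha hb
        exact shift_injective q.1.1 (ha.2.trans hb.2.symm)
    have h2 : (univ.filter fun x : FinTorusSite L L L t => x.shift q.1.2 = e.1).card ≤ 1 :=
      Finset.card_le_one.2 fun a ha b hb => by
        rw [Finset.mem_filter] at ha hb
        exact shift_injective q.1.2 (ha.2.trans hb.2.symm)
    have hA := Finset.card_union_le ({e.1} ∪ (univ.filter fun x : FinTorusSite L L L t => x.shift q.1.1 = e.1))
      (univ.filter fun x : FinTorusSite L L L t => x.shift q.1.2 = e.1)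
    have hB := Finset.card_union_le ({e.1} : Finset (FinTorusSite L L L t))
      (univ.filter fun x : FinTorusSite L L L t => x.shift q.1.1 = e.1)
    have hs : ({e.1} : Finset (FinTorusSite L L L t)).card = 1 := Finset.card_singleton _
    rw [hExc]
    omega
  refine prod_le_pow_mul_prod Exc hcard (one_le_kap w hw hε (1 : G)) (fun x => (weight_pos w hw hε _).le)
    (fun x => (weight_pos w hw hε _).le) (fun x hx => ?_) (fun x => weight_le_kap_mul w hw hε _ _)
  have hx : x ≠ e.1 ∧ x.shift q.1.1 ≠ e.1 ∧ x.shift q.1.2 ≠ e.1 := by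
    simpa [hExc, Finset.mem_union, Finset.mem_filter, not_or] using hx
  rw [plaquette_update_of_ne U e c x q.1.1 q.1.2 (fun h => hx.1 (congrArg Prod.fst h))
    (fun h => hx.2.1 (congrArg Prod.fst h)) (fun h => hx.2.2 (congrArg Prod.fst h)) (fun h => hx.1 (congrArg Prod.fst h))]

/-- The same in the other direction: `∏_x w(U_{x;ab}) ≤ κ³ ∏_x w(U'_{x;ab})`. -/
theorem prod_sites_le_update (hw : ∀ a, |w a - 1| ≤ ε) (hε : ε ≤ 1 / 2) (U : FinTorusSite L L L t × Fin 4 → G)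
    (e : FinTorusSite L L L t × Fin 4) (c : G) (q : {q : Fin 4 × Fin 4 // q.1 < q.2}) :
    ∏ x : FinTorusSite L L L t, w (finTorusPlaquette U x q.1.1 q.1.2) ≤
      ((1 + ε) / (1 - ε)) ^ 3 *
        ∏ x : FinTorusSite L L L t, w (finTorusPlaquette (Function.update U e (c * U e)) x q.1.1 q.1.2) := by
  classical
  set Exc : Finset (FinTorusSite L L L t) :=
    {e.1} ∪ (univ.filter fun x => x.shift q.1.1 = e.1) ∪ (univ.filter fun x => x.shift q.1.2 = e.1) with hExc
  have hcard : Exc.card ≤ 3 := by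
    have h1 : (univ.filter fun x : FinTorusSite L L L t => x.shift q.1.1 = e.1).card ≤ 1 :=
      Finset.card_le_one.2 fun a ha b hb => by
        rw [Finset.mem_filter] at ha hb
        exact shift_injective q.1.1 (ha.2.trans hb.2.symm)
    have h2 : (univ.filter fun x : FinTorusSite L L L t => x.shift q.1.2 = e.1).card ≤ 1 :=
      Finset.card_le_one.2 fun a ha b hb => by
        rw [Finset.mem_filter] at ha hb
        exact shift_injective q.1.2 (ha.2.trans hb.2.symm)
    have hA := Finset.card_union_le ({e.1} ∪ (univ.filter fun x : FinTorusSite L L L t => x.shift q.1.1 = e.1))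
      (univ.filter fun x : FinTorusSite L L L t => x.shift q.1.2 = e.1)
    have hB := Finset.card_union_le ({e.1} : Finset (FinTorusSite L L L t))
      (univ.filter fun x : FinTorusSite L L L t => x.shift q.1.1 = e.1)
    have hs : ({e.1} : Finset (FinTorusSite L L L t)).card = 1 := Finset.card_singleton _
    rw [hExc]
    omega
  refine prod_le_pow_mul_prod Exc hcard (one_le_kap w hw hε (1 : G)) (fun x => (weight_pos w hw hε _).le)
    (fun x => (weight_pos w hw hε _).le) (fun x hx => ?_) (fun x => weight_le_kap_mul w hw hε _ _)
  have hx : x ≠ e.1 ∧ x.shift q.1.1 ≠ e.1 ∧ x.shift q.1.2 ≠ e.1 := by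
    simpa [hExc, Finset.mem_union, Finset.mem_filter, not_or] using hx
  rw [plaquette_update_of_ne U e c x q.1.1 q.1.2 (fun h => hx.1 (congrArg Prod.fst h))
    (fun h => hx.2.1 (congrArg Prod.fst h)) (fun h => hx.2.2 (congrArg Prod.fst h)) (fun h => hx.1 (congrArg Prod.fst h))]

/-- **The untwisted weight `W = ∏_p w(U_p)` changes by at most `κ¹⁸` under `U_e ↦ c·U_e`** (3 sites × 6 planes). -/
theorem weightProd_update_le (hw : ∀ a, |w a - 1| ≤ ε) (hε : ε ≤ 1 / 2) (U : FinTorusSite L L L t × Fin 4 → G)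
    (e : FinTorusSite L L L t × Fin 4) (c : G) :
    (∏ x : FinTorusSite L L L t, ∏ q : {q : Fin 4 × Fin 4 // q.1 < q.2},
        w (finTorusPlaquette (Function.update U e (c * U e)) x q.1.1 q.1.2)) ≤
      ((1 + ε) / (1 - ε)) ^ 18 * ∏ x : FinTorusSite L L L t, ∏ q : {q : Fin 4 × Fin 4 // q.1 < q.2},
        w (finTorusPlaquette U x q.1.1 q.1.2) := by
  rw [Finset.prod_comm, Finset.prod_comm (s := (univ : Finset (FinTorusSite L L L t)))]
  calc ∏ q : {q : Fin 4 × Fin 4 // q.1 < q.2}, ∏ x : FinTorusSite L L L t,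
          w (finTorusPlaquette (Function.update U e (c * U e)) x q.1.1 q.1.2)
      ≤ ∏ q : {q : Fin 4 × Fin 4 // q.1 < q.2}, (((1 + ε) / (1 - ε)) ^ 3 *
          ∏ x : FinTorusSite L L L t, w (finTorusPlaquette U x q.1.1 q.1.2)) :=
        Finset.prod_le_prod (fun q _ => Finset.prod_nonneg fun x _ => (weight_pos w hw hε _).le)
          fun q _ => prod_sites_update_le w hw hε U e c q
    _ = ((1 + ε) / (1 - ε)) ^ 18 * ∏ q : {q : Fin 4 × Fin 4 // q.1 < q.2}, ∏ x : FinTorusSite L L L t,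
          w (finTorusPlaquette U x q.1.1 q.1.2) := by
        rw [Finset.prod_mul_distrib, Finset.prod_const, Finset.card_univ,
          show Fintype.card {q : Fin 4 × Fin 4 // q.1 < q.2} = 6 from by decide]; ring

/-- … and in the other direction. -/
theorem weightProd_le_update (hw : ∀ a, |w a - 1| ≤ ε) (hε : ε ≤ 1 / 2) (U : FinTorusSite L L L t × Fin 4 → G)
    (e : FinTorusSite L L L t × Fin 4) (c : G) :
    (∏ x : FinTorusSite L L L t, ∏ q : {q : Fin 4 × Fin 4 // q.1 < q.2}, w (finTorusPlaquette U x q.1.1 q.1.2)) ≤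
      ((1 + ε) / (1 - ε)) ^ 18 * ∏ x : FinTorusSite L L L t, ∏ q : {q : Fin 4 × Fin 4 // q.1 < q.2},
        w (finTorusPlaquette (Function.update U e (c * U e)) x q.1.1 q.1.2) := by
  rw [Finset.prod_comm, Finset.prod_comm (s := (univ : Finset (FinTorusSite L L L t)))]
  calc ∏ q : {q : Fin 4 × Fin 4 // q.1 < q.2}, ∏ x : FinTorusSite L L L t, w (finTorusPlaquette U x q.1.1 q.1.2)
      ≤ ∏ q : {q : Fin 4 × Fin 4 // q.1 < q.2}, (((1 + ε) / (1 - ε)) ^ 3 *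
          ∏ x : FinTorusSite L L L t, w (finTorusPlaquette (Function.update U e (c * U e)) x q.1.1 q.1.2)) :=
        Finset.prod_le_prod (fun q _ => Finset.prod_nonneg fun x _ => (weight_pos w hw hε _).le)
          fun q _ => prod_sites_le_update w hw hε U e c q
    _ = ((1 + ε) / (1 - ε)) ^ 18 * ∏ q : {q : Fin 4 × Fin 4 // q.1 < q.2}, ∏ x : FinTorusSite L L L t,
          w (finTorusPlaquette (Function.update U e (c * U e)) x q.1.1 q.1.2) := by
        rw [Finset.prod_mul_distrib, Finset.prod_const, Finset.card_univ,
          show Fintype.card {q : Fin 4 × Fin 4 // q.1 < q.2} = 6 from by decide]; ring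

/-- **Pointwise consequence**: `|W(U) − W(U')| ≤ (κ¹⁸ − 1)·W(U)`. -/
theorem abs_weightProd_sub_update_le (hw : ∀ a, |w a - 1| ≤ ε) (hε : ε ≤ 1 / 2)
    (U : FinTorusSite L L L t × Fin 4 → G) (e : FinTorusSite L L L t × Fin 4) (c : G) :
    |(∏ x : FinTorusSite L L L t, ∏ q : {q : Fin 4 × Fin 4 // q.1 < q.2}, w (finTorusPlaquette U x q.1.1 q.1.2)) -
      ∏ x : FinTorusSite L L L t, ∏ q : {q : Fin 4 × Fin 4 // q.1 < q.2},
        w (finTorusPlaquette (Function.update U e (c * U e)) x q.1.1 q.1.2)| ≤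
      (((1 + ε) / (1 - ε)) ^ 18 - 1) * ∏ x : FinTorusSite L L L t, ∏ q : {q : Fin 4 × Fin 4 // q.1 < q.2},
        w (finTorusPlaquette U x q.1.1 q.1.2) := by
  set K : ℝ := ((1 + ε) / (1 - ε)) ^ 18 with hK
  set W : ℝ := ∏ x : FinTorusSite L L L t, ∏ q : {q : Fin 4 × Fin 4 // q.1 < q.2},
    w (finTorusPlaquette U x q.1.1 q.1.2) with hW
  set W' : ℝ := ∏ x : FinTorusSite L L L t, ∏ q : {q : Fin 4 × Fin 4 // q.1 < q.2},
    w (finTorusPlaquette (Function.update U e (c * U e)) x q.1.1 q.1.2) with hW'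
  have h1 : W' ≤ K * W := weightProd_update_le w hw hε U e c
  have h2 : W ≤ K * W' := weightProd_le_update w hw hε U e c
  have hK1 : 1 ≤ K := one_le_pow₀ (one_le_kap w hw hε (1 : G))
  have hW0 : 0 ≤ W := Finset.prod_nonneg fun x _ => Finset.prod_nonneg fun q _ => (weight_pos w hw hε _).le
  have hKpos : 0 < K := lt_of_lt_of_le one_pos hK1
  rw [abs_le]
  constructor
  · -- `W' − W ≤ (K − 1) W`
    linarith
  · -- `W − W' ≤ W − W/K = W (1 − 1/K) ≤ (K − 1) W`
    have h3 : W / K ≤ W' := by rw [div_le_iff₀ hKpos]; linarith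
    have h4 : 1 - 1 / K ≤ K - 1 := by
      have e1 : 1 - 1 / K = (K - 1) / K := by rw [sub_div, div_self hKpos.ne']
      rw [e1, div_le_iff₀ hKpos]
      nlinarith [sq_nonneg (K - 1)]
    have h5 : W - W' ≤ W * (1 - 1 / K) := by
      have : W * (1 - 1 / K) = W - W / K := by ring
      linarith
    nlinarith

end WeightProduct

/-! ## §7 Counting the stack positions -/

section Count

variable {L t : ℕ}

/-- In the plane `(μ, 3)`, `μ ≠ 3`, the stack `{x₃ = 0, x_μ = 0}` has at most `L²` sites. -/
theorem card_stack_sites_le (μ : Fin 4) (hμ : μ ≠ 3) :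
    (univ.filter fun x : FinTorusSite L L L t => finTorusSiteCoord x 3 = 0 ∧ finTorusSiteCoord x μ = 0).card ≤ L * L := by
  have hLL : (univ : Finset (Fin L × Fin L)).card = L * L := by simp
  rw [← hLL]
  have hμ' : μ = 0 ∨ μ = 1 ∨ μ = 2 := by
    fin_cases μ <;> simp_all
  rcases hμ' with rfl | rfl | rfl
  · refine Finset.card_le_card_of_injOn (fun x => (x.2.1, x.2.2.1)) (fun x _ => Finset.mem_univ _) ?_
    rintro ⟨a0, a1, a2, a3⟩ ha ⟨b0, b1, b2, b3⟩ hb hab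
    simp only [Finset.coe_filter, Finset.mem_univ, true_and, Set.mem_setOf_eq, finTorusSiteCoord,
      Fin.isValue, Matrix.cons_val, Matrix.cons_val_zero] at ha hb
    simp only [Prod.mk.injEq] at hab ⊢
    exact ⟨Fin.ext (by omega), hab.1, hab.2, Fin.ext (by omega)⟩
  · refine Finset.card_le_card_of_injOn (fun x => (x.1, x.2.2.1)) (fun x _ => Finset.mem_univ _) ?_
    rintro ⟨a0, a1, a2, a3⟩ ha ⟨b0, b1, b2, b3⟩ hb hab
    simp only [Finset.coe_filter, Finset.mem_univ, true_and, Set.mem_setOf_eq, finTorusSiteCoord,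
      Fin.isValue, Matrix.cons_val, Matrix.cons_val_one] at ha hb
    simp only [Prod.mk.injEq] at hab ⊢
    exact ⟨hab.1, Fin.ext (by omega), hab.2, Fin.ext (by omega)⟩
  · refine Finset.card_le_card_of_injOn (fun x => (x.1, x.2.1)) (fun x _ => Finset.mem_univ _) ?_
    rintro ⟨a0, a1, a2, a3⟩ ha ⟨b0, b1, b2, b3⟩ hb hab
    simp only [Finset.coe_filter, Finset.mem_univ, true_and, Set.mem_setOf_eq, finTorusSiteCoord,
      Fin.isValue, Matrix.cons_val] at ha hb
    simp only [Prod.mk.injEq] at hab ⊢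
    exact ⟨hab.1, hab.2, Fin.ext (by omega), Fin.ext (by omega)⟩

/-- Summing a constant over the stack positions: `Σ_x Σ_q [stack] · C ≤ 3L² · C` (`C ≥ 0`). -/
theorem sum_stack_indicator_le {C : ℝ} (hC : 0 ≤ C) :
    ∑ x : FinTorusSite L L L t, ∑ q : {q : Fin 4 × Fin 4 // q.1 < q.2},
        (if (q.1.2 = 3 ∧ finTorusSiteCoord x 3 = 0 ∧ finTorusSiteCoord x q.1.1 = 0) then C else 0) ≤
      3 * ((L : ℝ) * L) * C := by
  classical
  rw [Finset.sum_comm]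
  have hq : ∀ q : {q : Fin 4 × Fin 4 // q.1 < q.2},
      ∑ x : FinTorusSite L L L t, (if (q.1.2 = 3 ∧ finTorusSiteCoord x 3 = 0 ∧ finTorusSiteCoord x q.1.1 = 0) then C else 0) ≤
        if q.1.2 = 3 then ((L : ℝ) * L) * C else 0 := by
    intro q
    by_cases hq3 : q.1.2 = 3
    · rw [if_pos hq3]
      have hμ : q.1.1 ≠ 3 := by
        intro h
        have hlt := q.2
        rw [h, hq3] at hlt
        exact lt_irrefl _ hlt
      rw [Finset.sum_ite, Finset.sum_const_zero, add_zero, Finset.sum_const, nsmul_eq_mul]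
      have hc := card_stack_sites_le (L := L) (t := t) q.1.1 hμ
      have hfilt : (univ.filter fun x : FinTorusSite L L L t =>
          q.1.2 = 3 ∧ finTorusSiteCoord x 3 = 0 ∧ finTorusSiteCoord x q.1.1 = 0) =
          univ.filter fun x : FinTorusSite L L L t => finTorusSiteCoord x 3 = 0 ∧ finTorusSiteCoord x q.1.1 = 0 :=
        Finset.filter_congr fun x _ => by simp [hq3]
      rw [hfilt]
      have hc' : ((univ.filter fun x : FinTorusSite L L L t =>
          finTorusSiteCoord x 3 = 0 ∧ finTorusSiteCoord x q.1.1 = 0).card : ℝ) ≤ (L : ℝ) * L := by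
        exact_mod_cast hc
      exact mul_le_mul_of_nonneg_right hc' hC
    · rw [if_neg hq3]
      simp [hq3]
  calc ∑ q : {q : Fin 4 × Fin 4 // q.1 < q.2}, ∑ x : FinTorusSite L L L t,
          (if (q.1.2 = 3 ∧ finTorusSiteCoord x 3 = 0 ∧ finTorusSiteCoord x q.1.1 = 0) then C else 0)
      ≤ ∑ q : {q : Fin 4 × Fin 4 // q.1 < q.2}, (if q.1.2 = 3 then ((L : ℝ) * L) * C else 0) :=
        Finset.sum_le_sum fun q _ => hq q
    _ = 3 * ((L : ℝ) * L) * C := by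
        rw [Finset.sum_ite, Finset.sum_const_zero, add_zero, Finset.sum_const, nsmul_eq_mul,
          show (univ.filter fun q : {q : Fin 4 × Fin 4 // q.1 < q.2} => q.1.2 = 3).card = 3 from by decide]
        push_cast; ring

end Count

end Summit.QuantumFields.YangMills.Cruxes.IRcof.MKLagSandwich.SCTwist

end
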